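import Summits.BirchSwinnertonDyer.BirchSwinnertonDyer.Theorems.EisensteinPrimesFullDescentMinkowski
import Literature.NumberTheory.NumberFields.InertiaGeneratesGalois
import HarnessLib

/-!
# Crux `GoodLatticeBDPValue` (stmt-BirchSwinnertonDyer-19032), line `halves`, AN-3 Stub B road — brick F4b:
# MINKOWSKI, Galois form: inside a Galois number field, a subgroup cutting out a discriminant-`±3`
# quadratic field contains no proper subgroup swallowing all its inertia

Width seat bsd-line-x1-p1-w3 (gen 4). HONEST FRAMING (cell `bsd-eis`, run/shared/lean/pub/bsd-eis/):
TOOL THEOREM ONLY (no `def`, no named fact, no `sorry`); classical algebraic number theory; nothing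
about a summit statement, Keller–Yin Thm. 2.2.2 or crux 2 is proved here; 0 stubs / cells / labels move.

WHY (road memo `HOME/line-x1-p1-w3-g4/AN3-StubB-elementary-road.md`, evidence #44, global input
(G-K) for the splitting lemma F5 `FullDescentSplitting.exists_stable_complement_mod`, hypothesis
`hGK`). In the finite Galois extension `L = ℚ(E[3])` (or `ℚ(3⁻¹C)`) with group `G`, let `H` be the
subgroup fixing `ζ₃` (index `2`, fixed field `ℚ(ζ₃)` of discriminant `−3`) and `H'` the kernel of
the cocycle-homomorphism `η`. The local information says: every inertia group of `G`, intersected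
with `H`, lies in `H'`. CONCLUSION (this file): `H' = H` — because `L^{H'} / L^{H}` is then unramified
at every prime (inertia groups of a Galois group have order the ramification index, Mathlib
`Ideal.card_inertia_eq_ramificationIdxIn` as packaged in the tree's
`NumberFields.InertiaGeneratesGalois.card_inertia_eq_ramificationIdx`, and `e` is multiplicative in
towers, `Ideal.ramificationIdx_tower`), so brick F4a
(`FullDescentMinkowski.finrank_eq_one_of_forall_isUnramifiedAt_of_natAbs_discr_eq_three`, Minkowski)
forces `[L^{H'} : L^{H}] = 1`.

* `subgroup_le_of_forall_inertia_inf_le` — `L` a number field with finite Galois group `G` over `ℚ`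
  (`IsGaloisGroup G ℚ L`), `H, H' ≤ G`, the fixed field of `H` of degree `2` and discriminant `±3`,
  and `I(Q) ∩ H ⊆ H'` for every maximal ideal `Q` of `𝓞 L` ⟹ `H ≤ H'`.

References: [NeukirchANT1999] Ch. I §9 (9.6) (inertia group and ramification index), Ch. III
(2.17) (Minkowski); [Cassels1986] Ch. 10 Thm. 12.1.
-/

noncomputable section

open NumberField Ideal Module

set_option autoImplicit false
set_option linter.dupNamespace false

namespace Summit.BirchSwinnertonDyer.BirchSwinnertonDyer.Theorems.FullDescentMinkowski

open Literature.NumberTheory.NumberFields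

/-- **Minkowski over `ℚ(ζ₃)`, Galois form.** Let `L` be a number field with finite Galois group `G`
over `ℚ`, `H, H'` subgroups of `G` such that the fixed field of `H` has degree `2` and discriminant
`±3`, and suppose that for every maximal ideal `Q` of `𝓞 L` the inertia group `I(Q) ≤ G` satisfies
`I(Q) ∩ H ⊆ H'`. Then `H ≤ H'`: the extension `L^{H'}/L^{H}` is unramified everywhere, hence trivial.
[cite: NeukirchANT1999, Ch. I §9 Prop. (9.6), Ch. III Thm. (2.17)] [cite: Cassels1986, Ch. 10 Thm. 12.1] -/
theorem subgroup_le_of_forall_inertia_inf_le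
    (L : Type*) [Field L] [NumberField L] (G : Type*) [Group G] [Finite G] [MulSemiringAction G L]
    [IsGaloisGroup G ℚ L] (H H' : Subgroup G)
    (hK : (discr (FixedPoints.intermediateField H : IntermediateField ℚ L)).natAbs = 3)
    (hK2 : finrank ℚ (FixedPoints.intermediateField H : IntermediateField ℚ L) = 2)
    (hI : ∀ (Q : Ideal (𝓞 L)) [Q.IsMaximal], ∀ σ : G, σ ∈ Q.inertia G → σ ∈ H → σ ∈ H') :
    H ≤ H' := by
  -- the quadratic field `K₁ = L^H` and the Galois group `H` of `L/K₁`
  set K₁ : IntermediateField ℚ L := FixedPoints.intermediateField H with hK₁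
  haveI hGH : IsGaloisGroup H K₁ L := IsGaloisGroup.subgroup G ℚ L H
  -- `H'` as a subgroup of `H`, its fixed field `M₁ = L^{H'} ⊇ K₁`
  set H₂ : Subgroup H := H'.subgroupOf H with hH₂
  set M₁ : IntermediateField K₁ L := FixedPoints.intermediateField H₂ with hM₁
  haveI hGH₂ : IsGaloisGroup H₂ M₁ L := IsGaloisGroup.subgroup H K₁ L H₂
  -- every maximal ideal of `𝓞 M₁` is unramified over `𝓞 K₁`
  have hunr : ∀ (P : Ideal (𝓞 M₁)) [P.IsMaximal], Algebra.IsUnramifiedAt (𝓞 K₁) P := by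
    intro P hP
    obtain ⟨Q, hQmax, hQP⟩ := exists_maximal_ideal_liesOver_of_isIntegral (S := 𝓞 L) P
    -- `e(Q | 𝓞 K₁) = e(P | 𝓞 K₁) * e(Q | 𝓞 M₁)`, and both inertia cards agree
    have htower := ramificationIdx_tower (R := 𝓞 K₁) P Q
    rw [← card_inertia_eq_ramificationIdx L H K₁ Q, ← card_inertia_eq_ramificationIdx L H₂ M₁ Q]
      at htower
    -- `I_H(Q) ↪ I_{H₂}(Q)`, `σ ↦ σ` (by `hI`), so `e(P | 𝓞 K₁) = 1`
    have key : ∀ I' : Subgroup H₂, (∀ σ : H, σ ∈ Q.inertia H → ∃ τ : H₂, τ ∈ I' ∧ ((τ : H) : G) = σ) →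
        Nat.card (Q.inertia H) = P.ramificationIdx (𝓞 K₁) * Nat.card I' →
        P.ramificationIdx (𝓞 K₁) = 1 := by
      intro I' hI' h
      have hinj : Nat.card (Q.inertia H) ≤ Nat.card I' := by
        refine Nat.card_le_card_of_injective
          (fun σ ↦ ⟨(hI' σ.1 σ.2).choose, (hI' σ.1 σ.2).choose_spec.1⟩) fun a b hab ↦ ?_
        have ha := (hI' a.1 a.2).choose_spec.2
        have hb := (hI' b.1 b.2).choose_spec.2
        have := congrArg (fun t : I' ↦ (((t : H₂) : H) : G)) hab
        simp only at this
        rw [ha, hb] at this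
        exact Subtype.ext (Subtype.ext this)
      have hpos : 0 < Nat.card (Q.inertia H) := Nat.card_pos
      by_contra hne
      rcases Nat.lt_or_ge (P.ramificationIdx (𝓞 K₁)) 1 with hlt | hge
      · have h0 : P.ramificationIdx (𝓞 K₁) = 0 := by omega
        rw [h0, zero_mul] at h
        omega
      · have h2 : 2 ≤ P.ramificationIdx (𝓞 K₁) := by omega
        nlinarith
    have he : P.ramificationIdx (𝓞 K₁) = 1 := by
      refine key _ (fun σ hσ ↦ ?_) htower
      have hσH' : (σ : G) ∈ H' := hI Q σ (fun x ↦ hσ x) σ.2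
      refine ⟨⟨σ, by rw [hH₂, Subgroup.mem_subgroupOf]; exact hσH'⟩, fun x ↦ hσ x, rfl⟩
    exact (ramificationIdx_eq_one_iff (R := 𝓞 K₁) (q := P)).mp he
  -- Minkowski: `[M₁ : K₁] = 1`
  have hfin : finrank K₁ M₁ = 1 :=
    finrank_eq_one_of_forall_isUnramifiedAt_of_natAbs_discr_eq_three hK hK2 hunr
  -- hence `#H₂ = #H`, `H₂ = ⊤`, `H ≤ H'`
  have hcardH : Nat.card H₂ = Nat.card H := by
    rw [IsGaloisGroup.card_eq_finrank H₂ M₁ L, IsGaloisGroup.card_eq_finrank H K₁ L,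
      ← finrank_mul_finrank K₁ M₁ L, hfin, one_mul]
  have htop : H₂ = ⊤ := Subgroup.eq_top_of_card_eq H₂ hcardH
  intro σ hσ
  have : (⟨σ, hσ⟩ : H) ∈ H₂ := by rw [htop]; exact Subgroup.mem_top _
  rw [hH₂, Subgroup.mem_subgroupOf] at this
  exact this

end Summit.BirchSwinnertonDyer.BirchSwinnertonDyer.Theorems.FullDescentMinkowski
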